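import Summits.BirchSwinnertonDyer.Rank1Residual.ManinAdditive.ShimuraLedger
import Literature.NumberTheory.EllipticCurves.ModularSymbols
import HarnessLib
import HarnessLib.Audit.Tags

/-!
# Candidates E-an-73 / 74 / 75, the tame/wild split of the blind residual and the explicit family at `N = 4(m² + 4)` —
# the ČNS ODD-DEGREE TOOTH at `2` bites exactly the blind TAME residual of C2 (an g17, MEMO-an §59) — cell `bsd-f2-manin`
# (D-0131 (3) frontier: the Manin constant at additive primes)

HONEST FRAMING.  LENS = analytic / period-lattice (planner `bsd-f2-manin-an`, g17; HOME
`run/shared/lean/pub/bsd-f2-manin/MEMO-an-59.md` ac67e10e158f2ede «THE ČNS ODD-DEGREE TOOTH AT 2»).  Source: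
HOME/an/Sketch-an-g17.lean sha16 **5ae25f8aecfcb1ed** (farm rc 0), namespace `…Cruxes.ManinOddAtFour.OddDegreeTooth` ↦
`…ManinAdditive.OddDegreeTooth`, the candidate rows VERBATIM, with leaf-hygiene edits: (i) the route import
`…Theses.ManinLocalTwoThree` is dropped; (ii) the g17 copies of the g16 predicates (`blindCurve`, `AllRationalTwoTorsionBlind`,
`HasRationalTwoTorsion`, `RbTotallyBlind`) are NOT re-declared — they are imported from `ShimuraLedger.lean` (refuter-1 RB63:
the copies are definitionally equal, `Iff.rfl`); (iii) the EDGES that consume the printed ČNS 2024 Thm 1.2 through E-an-72 /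
72′ (`not_two_dvd_maninConstant_of_cns_of_odd_deg`, `natAbs_maninConstant_eq_one_of_cns_of_mazur_of_odd_deg` — TREE
THEOREMS, `Theorems/ManinLocalTwoThreeOddDegreeTooth.lean`, p621478: `rbTotallyBlindTame_of_cns_of_oddDegree`,
`fourPBlindFamilyManinOdd_of_cns_of_oddDegree`, `fourPBlindFamilyManinOne_of_cns_of_mazur_of_oddDegree`) stay on the
`Theorems/` side (no `Theorems/` import in a leaf; refuter-1 T-55d: 3-line glue for the C2 lead); (iv) refuter-1's kernel
facts and edges (HOME/ref1-C63-ang16g17-audit.lean b4486526c9f311ee `RefAudit63` (b)(c)) on the family are copied VERBATIM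
up to namespaces: `blindCurve_Δ`, `isElliptic_blindCurve`, `sourceCurve_Δ`, `isElliptic_sourceCurve`,
`hasRationalTwoTorsion_blindCurve`, `allRationalTwoTorsionBlind_blindCurve`, `maninOdd_blindCurve_of_rbTotallyBlind`,
`rbTotallyBlindTame_of_rbTotallyBlind`, **`fourPBlindFamilyOddDegree_of_blindTame` (E-an-73 ⟹ E-an-74)**,
`fourPBlindFamilyManinOdd_of_rbTotallyBlindTame`, `fourPBlindFamilyManinOdd_of_maninOddBlindFamily` (E-an-69 ⟹),
`fourPBlindFamilyManinOdd_of_transfer` (the §58 → §59 funnel, existence fact as a hypothesis).  `@[conjecture]` on the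
seven law / residual / implication rows.  Filed on the C2 lead's typing ask A-p1-1 (2026-08-28T09:45:35Z: «E-an-73/74 … so
the tame half of C2's `stub_blindOrbitMinimalResidual` can be split by name») once refuter-1 §R55 had passed them.

THE ROWS.  **E-an-73 `BlindTameOptimalOddDegree`** (LAW, `c`-FREE): an `X₀(N)`-optimal globally minimal curve with
`4 ∥ N`, `a₁ = a₃ = 0`, non-trivial and entirely BLIND rational 2-torsion has ODD modular degree — in Cremona's range its
instances are EXACTLY the 55 family classes (refuter-1 engine 2: 55/55, and no other optimal class satisfies the
hypotheses among 897 670, T5/T6; T-55c: the row is the datum-free restatement of 74 plus «no other totally-blind tame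
optimal curve exists ≤ 5·10⁵»).  **E-an-74 `FourPBlindFamilyOddDegree`** (LAW, `c`-free, BEYOND PRINT as a statement):
for `m ≡ 1 (mod 4)` (`Int.emod`: m = −3, −7 ARE in scope — 52a1, 212b1) with `p = m² + 4` prime, the lattice-optimal
`X₀(4p)`-datum of `E′_m : y² = x³ − 2m x² + (m²+4) x` has ODD degree (55/55: degrees 1, 3, 15, 21, 123, …); Yazdani
Thm 3.8 case 4 proves «odd congruence number ⇒ this family», the converse is his printed open EXPECTATION («we expect …
we do not yet know of a proof», p. 15) — E-an-74 is its weaker modular-degree shadow.  `FourPBlindFamilyManinOdd` /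
`FourPBlindFamilyManinOne`: C2 / Manin on the family (open instances).  **E-an-75 `FourPBlindFamilyQuarterSymbol`**
(`c`-free, one modular symbol per level: `{∞, 1/4}_f ∉ Λ_f`), implied by 74 on paper (`λ₄ = −1`, `w_p`-invariance,
`φ₀(w_p ∞) ∈ E₀(ℚ)[2] = {O, T}`; Yazdani 2011 Lemmas 2.3–2.5) — recorded with the named implication
`OddDegreeForcesQuarterSymbol` (statement only: no `w_Q`-functional equation for `φ` in the tree).  `RbTotallyBlindTame` /
`RbTotallyBlindWild`: the split of `ShimuraLedger.RbTotallyBlind` by `8 ∤ N` / `8 ∣ N` (tame = the 55 classes at `4p`;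
wild = the 31 `χ₋₁`-twists at `16p`, `v₂(deg φ₀) = 2`, no tooth, + 32a1, 128b1/d1).

REFUTER VERDICTS: REF1 §R55 = R-an-32 (2026-08-28T09:51:07Z; report HOME/ref1/R55-ref1-ang16-g17.md c274d3d19125c095; probes
F1/F2 CLEAN): **ALL ROWS SURVIVE** — 73 LAW (c-free), 74 LAW beyond print (right direction), 75 LAW implied by 74 on paper,
`OddDegreeForcesQuarterSymbol` TRUE on paper, the Rb split and `FourPBlindFamilyManinOdd/One` open instances, hypotheses
non-vacuous (`isElliptic_blindCurve`, family globally minimal by Tate at 2: `m ≡ 1 (4)` IV*, f₂ = 2; level = conductor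
exactly when `m ≡ 1 (4)` and `m² + 4` prime); E-an-72/72′ TREE THEOREMS (57 classes with `B₂ = 0`: 55 family + 24a1 +
36a1).  CENSUS (BC5): HOME/an/g17-blind-degphi.out c9e2152afa62fc94 + refuter-1 R55-e55blind.out d96a2221c878ff34 /
R55-famtate.out b8d7eb4ee2e1d729.  REF2 R-an-32 (b) placement: imc g15 (a)(b)(c) confirmed by refuter-1 at page level
(Yazdani arXiv:0910.0571 §3.5 p. 14–15, Thm 3.8 case 4, p. 15 L59–66; Stein–Watkins 2004 Thm 2.1 the prime-level sibling;
Calegari–Emerton Thm 1 consistent).  bears_on: stmt-BirchSwinnertonDyer-22967 (C2 `ManinOddAtFour`, stub 6: the tame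
half `RbTotallyBlindTame` closes BY NAME from EITHER E-an-73 (ČNS road, with p621478) OR `ManinOddBlindFamily` /
`RbTotallyBlind` (ledger road), refuter-1 T-55d).  PARTITION 0 · beyond-print theorem: no · BSD is not proved by this;
Manin's conjecture is not proved by this.
-/

set_option autoImplicit false

noncomputable section

open Literature.NumberTheory.EllipticCurves Literature.NumberTheory.EllipticCurves.ModularForms
open WeierstrassCurve
open Summit.BirchSwinnertonDyer.Rank1Residual.ManinAdditive.CuspidalKummer
open Summit.BirchSwinnertonDyer.Rank1Residual.ManinAdditive.ShimuraLedger

namespace Summit.BirchSwinnertonDyer.Rank1Residual.ManinAdditive.OddDegreeTooth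

/-! ### §1. The explicit family: binders inhabited, blindness satisfied (refuter-1 RB63 (b), VERBATIM up to namespaces) -/

/-- `Δ(E′_m) = −256 (m² + 4)²`. (refuter-1 RB63, PROVED.) -/
theorem blindCurve_Δ (m : ℤ) : (blindCurve m).Δ = -256 * ((m : ℚ) ^ 2 + 4) ^ 2 := by
  simp only [blindCurve, WeierstrassCurve.Δ, WeierstrassCurve.b₂, WeierstrassCurve.b₄,
    WeierstrassCurve.b₆, WeierstrassCurve.b₈]
  ring

/-- `Δ(E′_m) ≠ 0`. (refuter-1 RB63, PROVED.) -/
theorem blindCurve_Δ_ne_zero (m : ℤ) : (blindCurve m).Δ ≠ 0 := by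
  rw [blindCurve_Δ]
  have h : (0 : ℚ) < ((m : ℚ) ^ 2 + 4) ^ 2 := by positivity
  intro h0
  have : (-256 : ℚ) * (((m : ℚ) ^ 2 + 4) ^ 2) < 0 := by nlinarith
  exact this.ne h0

/-- The `[IsElliptic]` binder of E-an-69 / E-an-74 / E-an-75 is inhabited for every `m`. (refuter-1 RB63, PROVED.) -/
theorem isElliptic_blindCurve (m : ℤ) : (blindCurve m).IsElliptic :=
  ⟨isUnit_iff_ne_zero.mpr (blindCurve_Δ_ne_zero m)⟩

/-- `Δ(E_m) = 16 (m² + 4)`. (refuter-1 RB63, PROVED.) -/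
theorem sourceCurve_Δ (m : ℤ) : (sourceCurve m).Δ = 16 * ((m : ℚ) ^ 2 + 4) := by
  simp only [sourceCurve, WeierstrassCurve.Δ, WeierstrassCurve.b₂, WeierstrassCurve.b₄,
    WeierstrassCurve.b₆, WeierstrassCurve.b₈]
  ring

/-- The `[IsElliptic]` binder of E-an-70 is inhabited for every `m`. (refuter-1 RB63, PROVED.) -/
theorem isElliptic_sourceCurve (m : ℤ) : (sourceCurve m).IsElliptic := by
  refine ⟨isUnit_iff_ne_zero.mpr ?_⟩
  rw [sourceCurve_Δ]
  have h : (0 : ℚ) < 16 * ((m : ℚ) ^ 2 + 4) := by positivity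
  exact h.ne'

/-- `(0,0)` is a rational 2-torsion point of `E′_m`. (refuter-1 RB63, PROVED.) -/
theorem hasRationalTwoTorsion_blindCurve (m : ℤ) : HasRationalTwoTorsion (blindCurve m) :=
  ⟨0, by simp [blindCurve]⟩

/-- Every rational 2-torsion point of `E′_m : y² = x((x − m)² + 4)` is `(0,0)`, and it is blind: the family satisfies the
blindness hypothesis of E-an-66 / `RbTotallyBlind` / E-an-73 for EVERY `m : ℤ`. (refuter-1 RB63, PROVED.) -/
theorem allRationalTwoTorsionBlind_blindCurve (m : ℤ) : AllRationalTwoTorsionBlind (blindCurve m) := by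
  intro e he
  have he' : e * ((e - m) ^ 2 + 4) = 0 := by
    simp only [blindCurve] at he
    linear_combination he
  have he0 : e = 0 := by
    rcases mul_eq_zero.mp he' with h | h
    · exact h
    · have : (0 : ℚ) < (e - m) ^ 2 + 4 := by positivity
      exact absurd h this.ne'
  refine ⟨-2 * m, m ^ 2 + 4, 0, ?_, ?_, ?_, kummerBlindAtTwo_blindCurve m⟩
  · simp [blindCurve]
  · simp [blindCurve]
  · simp [he0]

/-- The family row E-an-69 is an INSTANCE of the blind residual at every level with `4 ∣ N`. (refuter-1 RB63 (c), PROVED.) -/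
theorem maninOdd_blindCurve_of_rbTotallyBlind (h : RbTotallyBlind) (m : ℤ)
    [(blindCurve m).IsElliptic] [(blindCurve m).IsGloballyMinimal] {N : ℕ} [NeZero N]
    (D : ModularParametrizationData (blindCurve m) N)
    (hopt : ∀ z ∈ D.L.lattice, ∃ w ∈ periodLattice D.f, z = D.c * w) (h4 : 2 ^ 2 ∣ N) :
    ¬ (2 : ℤ) ∣ D.maninConstant :=
  h (blindCurve m) D hopt h4 rfl rfl (hasRationalTwoTorsion_blindCurve m) (allRationalTwoTorsionBlind_blindCurve m)

/-! ### §2. The tame / wild split of the blind residual (an g17 VERBATIM) -/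

/-- The TAME part (`4 ∥ N`) of the blind residual `ShimuraLedger.RbTotallyBlind` — in Cremona's range exactly the 55
`X₀`-optimal `E′_m`, `N = 4(m² + 4)`; the `8 ∣ N` part consists in range of the 31 `χ₋₁`-twists at `16(m²+4)` (excluded
from stub 6 by its orbit-minimality clause) and `32a1, 128b1, 128d1`. (an g17 VERBATIM; cell bsd-f2-manin; nothing
asserted.)
[cite: Cremona2022ManinConstants, Table (shape only: `c₀ = 1` on the 55 tame blind optimal classes `N < 5·10⁵`; C2 restricted, OPEN beyond)] -/
@[conjecture]
def RbTotallyBlindTame : Prop :=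
  ∀ (W : WeierstrassCurve ℚ) [W.IsElliptic] [W.IsGloballyMinimal] {N : ℕ} [NeZero N]
    (D : ModularParametrizationData W N),
    (∀ z ∈ D.L.lattice, ∃ w ∈ periodLattice D.f, z = D.c * w) → 2 ^ 2 ∣ N → ¬ 2 ^ 3 ∣ N → W.a₁ = 0 →
    W.a₃ = 0 → HasRationalTwoTorsion W → AllRationalTwoTorsionBlind W → ¬ (2 : ℤ) ∣ D.maninConstant

/-- The WILD part (`8 ∣ N`) of the blind residual (in range: the 31 `χ₋₁`-twists at `16(m²+4)`, `v₂(deg φ₀) = 2`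
exactly, ČNS `ε₂ = 1` — no tooth — and `32a1, 128b1, 128d1`; conjecturally nothing else: imc E-imc-29). (an g17 VERBATIM;
nothing asserted.)
[cite: Cremona2022ManinConstants, Table (shape only: `c₀ = 1` on the wild blind optimal classes `N < 5·10⁵`; C2 restricted, OPEN beyond)] -/
@[conjecture]
def RbTotallyBlindWild : Prop :=
  ∀ (W : WeierstrassCurve ℚ) [W.IsElliptic] [W.IsGloballyMinimal] {N : ℕ} [NeZero N]
    (D : ModularParametrizationData W N),
    (∀ z ∈ D.L.lattice, ∃ w ∈ periodLattice D.f, z = D.c * w) → 2 ^ 3 ∣ N → W.a₁ = 0 →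
    W.a₃ = 0 → HasRationalTwoTorsion W → AllRationalTwoTorsionBlind W → ¬ (2 : ℤ) ∣ D.maninConstant

/-- SPLIT (kernel-checked, an g17): blind residual = tame part ∪ wild part. -/
theorem rbTotallyBlind_of_tame_of_wild (ht : RbTotallyBlindTame) (hw : RbTotallyBlindWild) :
    RbTotallyBlind := by
  intro W _ _ N _ D hopt h4 ha₁ ha₃ hT hall
  by_cases h8 : 2 ^ 3 ∣ N
  · exact hw W D hopt h8 ha₁ ha₃ hT hall
  · exact ht W D hopt h4 h8 ha₁ ha₃ hT hall

/-- Blind residual ⟹ its tame part (drop `8 ∤ N`). (refuter-1 RB63 (c), PROVED.) -/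
theorem rbTotallyBlindTame_of_rbTotallyBlind (h : RbTotallyBlind) : RbTotallyBlindTame :=
  fun W _ _ _N _ D hopt h4 _h8 ha₁ ha₃ hT hall ↦ h W D hopt h4 ha₁ ha₃ hT hall

/-- Blind residual ⟹ its wild part (drop to `4 ∣ N`). (PROVED.) -/
theorem rbTotallyBlindWild_of_rbTotallyBlind (h : RbTotallyBlind) : RbTotallyBlindWild :=
  fun W _ _ _N _ D hopt h8 ha₁ ha₃ hT hall ↦
    h W D hopt (dvd_trans (pow_dvd_pow 2 (by norm_num : 2 ≤ 3)) h8) ha₁ ha₃ hT hall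

/-! ### §3. E-an-73: the blind tame parity law (an g17 VERBATIM) -/

/-- **Candidate E-an-73 `BlindTameOptimalOddDegree` (LAW, `c`-FREE; cell bsd-f2-manin, an g17; nothing asserted).**  An
`X₀(N)`-optimal globally minimal curve with `4 ∥ N`, written with `a₁ = a₃ = 0`, whose rational 2-torsion is non-trivial
and entirely BLIND, has ODD modular degree.  BC5: 55/55 (= every totally blind optimal curve with `4 ∥ N < 5·10⁵`;
`alldegphi`); refuter-1 T-55c: in range its instances are EXACTLY the 55 family classes (the datum-free restatement of
E-an-74 plus «no other totally-blind tame optimal curve exists ≤ 5·10⁵»).  Why it might fail: a totally blind optimal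
curve at `N = 4pq` beyond the table with even degree (Calegari–Emerton allow two odd primes); the family form E-an-74 is
the robust one.  REF1 §R55: SURVIVES — LAW.
[cite: Yazdani2009, Thm. 3.8 case 4 and p. 15 (shape only: odd CONGRUENCE number at `N = 4p` forces the family; the converse and this modular-degree law are NOT proved in print — «we expect … we do not yet know of a proof»)] -/
@[conjecture]
def BlindTameOptimalOddDegree : Prop :=
  ∀ (W : WeierstrassCurve ℚ) [W.IsElliptic] [W.IsGloballyMinimal] {N : ℕ} [NeZero N]
    (D : ModularParametrizationData W N),
    (∀ z ∈ D.L.lattice, ∃ w ∈ periodLattice D.f, z = D.c * w) → 2 ^ 2 ∣ N → ¬ 2 ^ 3 ∣ N → W.a₁ = 0 →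
    W.a₃ = 0 → HasRationalTwoTorsion W → AllRationalTwoTorsionBlind W → Odd D.deg

/-! ### §4. The explicit family at `N = 4(m² + 4)` (an g17 VERBATIM) -/

/-- **Candidate E-an-74 `FourPBlindFamilyOddDegree` (`c`-FREE parity law = the modular-degree half of imc's E-imc-28,
universally quantified; its congruence-number form is Yazdani's printed open expectation; cell bsd-f2-manin, an g17;
nothing asserted).**  For `m ≡ 1 (mod 4)` (`Int.emod`: `m = −3, −7` in scope) with `p = m² + 4` prime, the lattice-optimal
`X₀(4p)`-datum of `E′_m` has ODD degree.  BC5: 55/55 (`m = 1, −3, 5, −7, 13, …`; degrees `1, 3, 15, 21, 123, …`).  Cheapest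
falsifier beyond the table: ONE even `deg φ₀(E′_m)` at the 19 levels `4(m²+4) ∈ (5·10⁵, 10⁶]` computed in HOMOLOGY.
REF1 §R55: SURVIVES — LAW, beyond print in the right direction.
[cite: Yazdani2009, Thm. 3.8 case 4 and p. 15 (shape only: necessity printed; sufficiency = printed open expectation; the modular-degree form is the cell's row E-an-74)] -/
@[conjecture]
def FourPBlindFamilyOddDegree : Prop :=
  ∀ (m : ℤ) (p : ℕ) [NeZero (4 * p)] [(blindCurve m).IsElliptic] [(blindCurve m).IsGloballyMinimal]
    (D : ModularParametrizationData (blindCurve m) (4 * p)),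
    m % 4 = 1 → (p : ℤ) = m ^ 2 + 4 → p.Prime →
    (∀ z ∈ D.L.lattice, ∃ w ∈ periodLattice D.f, z = D.c * w) → Odd D.deg

/-- C2 on the explicit blind family at its conductor `4(m² + 4)` (= E-an-69 `ShimuraLedger.ManinOddBlindFamily` restricted
to the tame sub-family and stated at the explicit level). (an g17 VERBATIM; nothing asserted.)
[cite: Cremona2022ManinConstants, Table (shape only: `c₀ = 1` on the 55 members `N < 5·10⁵`; OPEN beyond)] -/
@[conjecture]
def FourPBlindFamilyManinOdd : Prop :=
  ∀ (m : ℤ) (p : ℕ) [NeZero (4 * p)] [(blindCurve m).IsElliptic] [(blindCurve m).IsGloballyMinimal]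
    (D : ModularParametrizationData (blindCurve m) (4 * p)),
    m % 4 = 1 → (p : ℤ) = m ^ 2 + 4 → p.Prime →
    (∀ z ∈ D.L.lattice, ∃ w ∈ periodLattice D.f, z = D.c * w) → ¬ (2 : ℤ) ∣ D.maninConstant

/-- Manin's conjecture `|c₀| = 1` on the explicit blind family. (an g17 VERBATIM; nothing asserted.)
[cite: Cremona2022ManinConstants, Table (shape only: `c₀ = 1` on the 55 members `N < 5·10⁵`; OPEN beyond)] -/
@[conjecture]
def FourPBlindFamilyManinOne : Prop :=
  ∀ (m : ℤ) (p : ℕ) [NeZero (4 * p)] [(blindCurve m).IsElliptic] [(blindCurve m).IsGloballyMinimal]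
    (D : ModularParametrizationData (blindCurve m) (4 * p)),
    m % 4 = 1 → (p : ℤ) = m ^ 2 + 4 → p.Prime →
    (∀ z ∈ D.L.lattice, ∃ w ∈ periodLattice D.f, z = D.c * w) → D.maninConstant.natAbs = 1

/-- Arithmetic of the family level: `p = m² + 4` with `m ≡ 1 (mod 4)` is odd, so `8 ∤ 4p`. (an g17, PROVED.) -/
theorem not_eight_dvd_level {m : ℤ} {p : ℕ} (hm : m % 4 = 1) (hp : (p : ℤ) = m ^ 2 + 4) :
    ¬ 2 ^ 3 ∣ 4 * p := by
  obtain ⟨k, hk⟩ : ∃ k : ℤ, m = 4 * k + 1 := ⟨m / 4, by omega⟩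
  have hodd : Odd (p : ℤ) := ⟨8 * k ^ 2 + 4 * k + 2, by rw [hp, hk]; ring⟩
  have hp2 : p % 2 = 1 := Nat.odd_iff.mp (by exact_mod_cast hodd)
  rintro ⟨c, hc⟩
  omega

/-- At the family level no odd prime divides `4p` to the second power. (an g17, PROVED.) -/
theorem not_sq_dvd_level {m : ℤ} {p : ℕ} (_hm : m % 4 = 1) (hp : (p : ℤ) = m ^ 2 + 4) (hpp : p.Prime)
    (q : ℕ) (hq : q.Prime) (hq2 : q ≠ 2) : ¬ q ^ 2 ∣ 4 * p := by
  intro hdvd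
  have hqp : q ∣ 4 * p := dvd_trans (dvd_pow_self q two_ne_zero) hdvd
  rcases (Nat.Prime.dvd_mul hq).mp hqp with h4 | h1
  · have : q ∣ 2 ^ 2 := by simpa using h4
    exact hq2 ((Nat.prime_dvd_prime_iff_eq hq Nat.prime_two).mp (hq.dvd_of_dvd_pow this))
  · have hqeq : q = p := (Nat.prime_dvd_prime_iff_eq hq hpp).mp h1
    subst hqeq
    -- `q² ∣ 4q` forces `q ∣ 4`, so `q = 2`: contradiction with `q ≠ 2`
    have h' : q * q ∣ 4 * q := by simpa [pow_two] using hdvd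
    have hq4 : q ∣ 4 := by
      obtain ⟨c, hc⟩ := h'
      refine ⟨c, ?_⟩
      have hq0 : 0 < q := hq.pos
      nlinarith [hc]
    have : q ∣ 2 ^ 2 := by simpa using hq4
    exact hq2 ((Nat.prime_dvd_prime_iff_eq hq Nat.prime_two).mp (hq.dvd_of_dvd_pow this))

/-- The family is `4 ∣ 4p`. -/
theorem four_dvd_level (p : ℕ) : 2 ^ 2 ∣ 4 * p := ⟨p, by ring⟩

/-- **E-an-73 ⟹ E-an-74 (refuter-1 RB63 (c), kernel-checked):** the explicit family at `N = 4(m²+4)`, `m ≡ 1 (mod 4)`, meets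
every hypothesis of the blind tame parity law: `4 ∣ 4p`, `8 ∤ 4p` (`not_eight_dvd_level`), `a₁ = a₃ = 0` (`rfl`), `(0,0)`
rational, all rational 2-torsion blind. (PROVED.) -/
theorem fourPBlindFamilyOddDegree_of_blindTame (h : BlindTameOptimalOddDegree) : FourPBlindFamilyOddDegree := by
  intro m p _ _ _ D hm hp _hpp hopt
  exact h (blindCurve m) D hopt (four_dvd_level p) (not_eight_dvd_level hm hp) rfl rfl
    (hasRationalTwoTorsion_blindCurve m) (allRationalTwoTorsionBlind_blindCurve m)

/-- `RbTotallyBlindTame` ⟹ C2 on the explicit family at `4(m²+4)`. (refuter-1 RB63 (c), PROVED.) -/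
theorem fourPBlindFamilyManinOdd_of_rbTotallyBlindTame (h : RbTotallyBlindTame) : FourPBlindFamilyManinOdd := by
  intro m p _ _ _ D hm hp _hpp hopt
  exact h (blindCurve m) D hopt (four_dvd_level p) (not_eight_dvd_level hm hp) rfl rfl
    (hasRationalTwoTorsion_blindCurve m) (allRationalTwoTorsionBlind_blindCurve m)

/-- **E-an-69 `ShimuraLedger.ManinOddBlindFamily` ⟹ `FourPBlindFamilyManinOdd`** (specialise the level). (refuter-1 RB63 (c),
PROVED.) -/
theorem fourPBlindFamilyManinOdd_of_maninOddBlindFamily (h : ManinOddBlindFamily) : FourPBlindFamilyManinOdd := by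
  intro m p _ i₁ i₂ D _hm _hp _hpp hopt
  exact h m D hopt

/-- The whole §58 → §59 funnel in one line: blind transfer ∧ existence of the `X₁(N)`-optimal datum (the Literature fact
`exists_optimal_gamma1ParametrizationData`, BY NAME) ∧ `C2¹` on blind classes ⟹ C2 on the
explicit tame family (`ShimuraLedger.rbTotallyBlind_of_transfer`, then the two edges above). (refuter-1 RB63 (c), PROVED.) -/
theorem fourPBlindFamilyManinOdd_of_transfer (ht : TotallyBlindGammaOneTransfer)
    (hex : exists_optimal_gamma1ParametrizationData) (h₁ : GammaOneOddOnBlindClasses) :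
    FourPBlindFamilyManinOdd :=
  fourPBlindFamilyManinOdd_of_rbTotallyBlindTame
    (rbTotallyBlindTame_of_rbTotallyBlind (rbTotallyBlind_of_transfer ht hex h₁))

/-- `ShimuraLedger.rbTotallyBlind_of_transfer` with the existence hypothesis fed BY NAME from the Literature fact
`exists_optimal_gamma1ParametrizationData` (Conrad–Edixhoven–Stein 2003 §6.1 / Stevens 1989 §2; typer p623346):
blind transfer (E-an-66) ∧ `C2¹` on blind classes ⟹ the blind residual of C2. (PROVED.) -/
theorem rbTotallyBlind_of_transfer_of_exists (ht : TotallyBlindGammaOneTransfer)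
    (hex : exists_optimal_gamma1ParametrizationData) (h₁ : GammaOneOddOnBlindClasses) : RbTotallyBlind :=
  rbTotallyBlind_of_transfer ht hex h₁

/-- On the family, `FourPBlindFamilyManinOne` ⟹ `FourPBlindFamilyManinOdd` (`|c₀| = 1 ⇒ 2 ∤ c₀`). (PROVED.) -/
theorem fourPBlindFamilyManinOdd_of_maninOne (h : FourPBlindFamilyManinOne) : FourPBlindFamilyManinOdd := by
  intro m p _ _ _ D hm hp hpp hopt hdvd
  have h1 := h m p D hm hp hpp hopt
  have : (2 : ℤ).natAbs ∣ D.maninConstant.natAbs := Int.natAbs_dvd_natAbs.mpr hdvd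
  rw [h1] at this
  norm_num at this

/-! ### §5. E-an-75: the cuspidal proxy — the blind point is the `w_p`-cuspidal point (an g17 VERBATIM) -/

/-- **Candidate E-an-75 `FourPBlindFamilyQuarterSymbol` (`c`-FREE, one modular symbol per level; cell bsd-f2-manin, an g17;
nothing asserted).**  For the optimal `E′_m` at `N = 4p`: the modular symbol `{∞, 1/4}_f` is NOT a period of `f`, i.e. the
cusp `1/4 = w_p(∞)` maps under `φ₀` to a non-zero point — necessarily the blind rational 2-torsion point `T = (0,0)`
(`φ₀ ∘ w_p = φ₀ + φ₀(w_p ∞)` because `λ_p(f) = +1`, non-split multiplicative reduction at `p`).  NECESSARY for odd degree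
(Yazdani 2011, Lemma 2.4: else `φ₀` factors through `X₀(4p)/w_p`), hence TRUE 55/55 in range with no extra computation;
beyond the table it is the cheapest `c`-free proxy of E-an-74.  REF1 §R55: SURVIVES — LAW, implied by 74 on paper
(`modularSymbol f r = {∞, r}_f`, so `∉ periodLattice D.f` is the right membership).
[cite: Yazdani2011, Lemmas 2.3–2.5 (shape only: the `w_Q`-functional equation of `φ` and the sign `λ_{4p} = λ_4 = −1`; the quarter-symbol law on the family is the cell's row E-an-75)] -/
@[conjecture]
def FourPBlindFamilyQuarterSymbol : Prop :=
  ∀ (m : ℤ) (p : ℕ) [NeZero (4 * p)] [(blindCurve m).IsElliptic] [(blindCurve m).IsGloballyMinimal]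
    (D : ModularParametrizationData (blindCurve m) (4 * p)),
    m % 4 = 1 → (p : ℤ) = m ^ 2 + 4 → p.Prime →
    (∀ z ∈ D.L.lattice, ∃ w ∈ periodLattice D.f, z = D.c * w) →
    modularSymbol D.f (1 / 4 : ℚ) ∉ periodLattice D.f

/-- The paper implication «odd degree ⟹ quarter symbol is not a period» at `N = 4p`, `p ≡ 1 (mod 4)` (Yazdani 2011,
Lemmas 2.3–2.5: `λ_{4p} = λ_4 = −1` from the fixed points `i/√N` of `w_N` and the cusp `1/2` of `w_4`, so `λ_p = +1`;
`φ₀ ∘ w_p = φ₀ + φ₀(1/4)`; `φ₀(1/4) = O` would factor `φ₀` through the double cover `X₀(4p) → X₀(4p)/w_p`).  Recorded as a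
named implication (statement only; NOT kernel-proved: the tree has no `w_Q`-functional equation for `φ`; refuter-1 §R55:
TRUE on paper). (an g17 VERBATIM; nothing asserted.)
[cite: Yazdani2011, Lemmas 2.3–2.5 (shape only: as for E-an-75)] -/
@[conjecture]
def OddDegreeForcesQuarterSymbol : Prop :=
  FourPBlindFamilyOddDegree → FourPBlindFamilyQuarterSymbol

/-! ### §6. Sanity (`decide` / `norm_num`): census keys (an g17 + refuter-1 RB63 (d)) -/

/-- The levels `4(m²+4)` at `m = 1, 3, 5, 7, 13`: `20, 52, 116, 212, 692`. -/
example : (4 * (1 ^ 2 + 4) = 20) ∧ (4 * (3 ^ 2 + 4) = 52) ∧ (4 * (5 ^ 2 + 4) = 116) ∧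
    (4 * (7 ^ 2 + 4) = 212) ∧ (4 * (13 ^ 2 + 4) = 692) := by decide

/-- `m % 4 = 1` is `Int.emod`: `m = −3, −7, 5, 13` are IN scope, `m = −1, 3, 7` (the `16p` twists) are NOT. -/
example : ((-3 : ℤ) % 4 = 1) ∧ ((-7 : ℤ) % 4 = 1) ∧ ((5 : ℤ) % 4 = 1) ∧ ((13 : ℤ) % 4 = 1) ∧ ((-1 : ℤ) % 4 = 3) ∧
    ((3 : ℤ) % 4 = 3) ∧ ((7 : ℤ) % 4 = 3) := by decide

/-- `blindCurve 1 = [0,−2,0,5,0]` is the translate `x ↦ x − 1` of 20a1 `[0,1,0,4,4]` (same discriminant `−6400`). -/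
example : (blindCurve 1).Δ = -6400 ∧ (⟨0, 1, 0, 4, 4⟩ : WeierstrassCurve ℚ).Δ = -6400 := by
  refine ⟨by rw [blindCurve_Δ]; norm_num, ?_⟩
  simp only [WeierstrassCurve.Δ, WeierstrassCurve.b₂, WeierstrassCurve.b₄, WeierstrassCurve.b₆, WeierstrassCurve.b₈]
  norm_num

end Summit.BirchSwinnertonDyer.Rank1Residual.ManinAdditive.OddDegreeTooth

end
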